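/-
Copyright (c) 2026. All rights reserved.
Released under Apache 2.0 license as described in the file LICENSE.
-/
import Literature.NumberTheory.PAdicHodge.SenFiniteVectorsDescent
import Mathlib.RingTheory.Trace.Basic
import Mathlib.FieldTheory.Galois.Basic
import HarnessLib

/-!
# Relative Tate coordinates: `ℂ_F^{H_N} = ⊕ᵢ bᵢ · \widehat{K_∞}` with bounded coordinate maps

The fourth file of the Sen-decompletion sequence (`SenFiniteVectorsBase`, `SenFiniteVectorsSubgroup`,
`SenFiniteVectorsDescent`).  Sen's theory for a representation of `Γ_F` (and the Tate–Sen condition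
(TS2) of Berger–Colmez for a general open subgroup `H ≤ H₀`) runs over the completed cyclotomic tower
`\widehat{L_∞} = ℂ_p^{H_L}` of a finite extension `L`, not over `X = \widehat{K_∞}` (`K₀ = ℚ_p`):
Berger–Colmez, Prop. 4.1.1, `Λ̃^{H_L} = \widehat{L_∞}`, `R_{H_L,n} = R_{L,n}`.  The passage from the
base tower to `\widehat{L_∞}` is by coordinates: for `N ⊆ F̄` finite Galois over `K₀`,
`H₀ = ker χ = Gal(F̄/K_∞)` and `H_N = H₀ ∩ Gal(F̄/N)`, we construct families `b, b^∨ : Fin e → N` and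
continuous additive **coordinate maps** `prᵢ : ℂ_F → ℂ_F`,

  `prᵢ(x) = ∑_{s ∈ H₀|_N} g_s • (b^∨ᵢ · x)`   (`g_s ∈ H₀` a lift of `s ∈ H₀|_N ≤ Gal(N/K₀)`),

with: `prᵢ` is `X`-linear and `‖prᵢ x‖ ≤ ‖b^∨ᵢ‖ ‖x‖`; for `x ∈ ℂ_F^{H_N}`, `prᵢ x ∈ X` and
`x = ∑ᵢ bᵢ prᵢ(x)`; `prᵢ(bⱼ c) = δᵢⱼ c` for `c ∈ X`; and `prᵢ` commutes with `Gal(F̄/N)` on `ℂ_F^{H_N}`.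
Hence `ℂ_F^{H_N} = ⊕ᵢ bᵢ X` is free over `X` with bounded coordinates — the input for transporting
Tate's normalised traces and Sen's decompletion from `X` to `\widehat{N K_∞}`
(`R^N_n := ∑ᵢ bᵢ R_n ∘ prᵢ`).  Here `b` is a basis of `N` over the fixed field `E = N^{H₀|_N}`
(`= N ∩ K_∞`) and `b^∨` its `Tr_{N/E}`-dual basis; the two **Galois dual-basis identities**
`∑_{s ∈ H₀|_N} s(b^∨ᵢ bⱼ) = δᵢⱼ` (`Tr_{N/E} = ∑_{s ∈ Gal(N/E)} s`, `Gal(N/E) = H₀|_N` by the Galois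
correspondence) and `∑ᵢ bᵢ s(b^∨ᵢ) = [s = 1]` (`sum_mul_aut_traceDual_eq`) drive everything.

Main results:
* `TateTrace.exists_relCoordinates` — ★ the coordinate package for `ℂ_F^{H_N}` over `X`.

References: L. Berger, P. Colmez, *Familles de représentations de de Rham et monodromie p-adique*,
Astérisque 319 (2008), Déf. 3.1.3 (TS2) and Prop. 4.1.1 [BergerColmez2008]; J. Tate, *p-divisible
groups* (1967), §3.1–§3.2 [Tate1967]; O. Brinon, B. Conrad, *CMI Summer School notes on p-adic Hodge
theory* (2009), Thm. 15.1.2 and Thm. 15.1.5 [BrinonConrad2009]; F. DeMeyer, E. Ingraham, *Separable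
algebras over commutative rings*, LNM 181 (1971), Ch. III Prop. 1.2 [DeMeyerIngraham1971].
-/

noncomputable section

open ValuativeRel Field UniformSpace Finset Module

namespace Literature.NumberTheory.PAdicHodge

/-! ### Galois dual families relative to a subgroup -/

section GaloisDualFamily

variable {K L : Type*} [Field K] [Field L] [Algebra K L] [FiniteDimensional K L] [IsGalois K L]

/-- `∑_{s ∈ S} s(x) = Tr_{L/L^S}(x)` for a subgroup `S ≤ Gal(L/K)` (`Gal(L/L^S) = S` and `Tr = ∑_σ σ` for
the Galois extension `L/L^S`). [folklore] -/
private theorem sum_subgroup_apply_eq_trace (S : Subgroup (L ≃ₐ[K] L)) [Fintype S] (x : L) :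
    ∑ s : S, (s : L ≃ₐ[K] L) x =
      algebraMap (IntermediateField.fixedField S) L
        (Algebra.trace (IntermediateField.fixedField S) L x) := by
  haveI : IsGalois (IntermediateField.fixedField S) L :=
    IsGalois.tower_top_of_isGalois K (IntermediateField.fixedField S) L
  rw [trace_eq_sum_automorphisms]
  exact Fintype.sum_equiv (IntermediateField.subgroupEquivAlgEquiv S).toEquiv _ _ fun s => rfl

/-- **Dual families relative to `S ≤ Gal(L/K)`.**  There are `e = [L : L^S] ≥ 1` and families
`b, b^∨ : Fin e → L` with `∑_{s ∈ S} s(b^∨_i b_j) = δ_{ij}` and `∑_i b_i s(b^∨_i) = [s = 1]` for `s ∈ S`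
(`b` an `L^S`-basis of `L`, `b^∨` its trace dual). [cite: DeMeyerIngraham1971, Ch. III Prop. 1.2 (2)(ii)] -/
private theorem exists_dual_family (S : Subgroup (L ≃ₐ[K] L)) [Fintype S] [DecidableEq S] :
    ∃ (e : ℕ) (b bd : Fin e → L), 0 < e ∧
      (∀ i j, ∑ s : S, (s : L ≃ₐ[K] L) (bd i * b j) = if i = j then 1 else 0) ∧
      (∀ s : S, ∑ i, b i * (s : L ≃ₐ[K] L) (bd i) = if s = 1 then 1 else 0) := by
  classical
  let E := IntermediateField.fixedField S
  haveI : IsGalois E L := IsGalois.tower_top_of_isGalois K E L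
  let bE : Basis (Fin (finrank E L)) E L := Module.finBasis E L
  refine ⟨finrank E L, fun i => bE i, fun i => bE.traceDual i, Module.finrank_pos, ?_, ?_⟩
  · intro i j
    dsimp only
    rw [sum_subgroup_apply_eq_trace S, bE.trace_traceDual_mul]
    by_cases h : i = j
    · subst h; simp
    · rw [if_neg (Ne.symm h), if_neg h, map_zero]
  · intro s
    dsimp only
    have h := sum_mul_aut_traceDual_eq bE (IntermediateField.subgroupEquivAlgEquiv S s)
    have h2 : ∑ i, bE i * (s : L ≃ₐ[K] L) (bE.traceDual i) =
        ∑ i, bE i * (IntermediateField.subgroupEquivAlgEquiv S s) (bE.traceDual i) :=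
      Finset.sum_congr rfl fun i _ => rfl
    rw [h2, h]
    by_cases hs : s = 1
    · rw [if_pos hs, if_pos (by rw [hs, map_one])]
    · rw [if_neg hs, if_neg (fun h' => hs ((MulEquiv.map_eq_one_iff _).mp h'))]

end GaloisDualFamily

/-! ### The coordinate package for `ℂ_F^{H_N}` over `X` -/

open Literature.NumberTheory.GaloisRepresentations
open Literature.NumberTheory.GaloisRepresentations.IsNonarchimedeanLocalField
open CyclotomicTower

variable {F : Type} [Field F] [ValuativeRel F] [TopologicalSpace F] [IsNonarchimedeanLocalField F]
  [CharZero F] {p : ℕ} [Fact p.Prime] (hp : valuation F p < 1)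

namespace TateTrace

variable (N : IntermediateField (PadicBase F p hp) (NormedAlgClosure F))
  [FiniteDimensional (PadicBase F p hp) N] [IsGalois (PadicBase F p hp) N]

omit [FiniteDimensional (PadicBase F p hp) N] in
/-- `g|_N = 1` iff `g` fixes `N` pointwise. [folklore] -/
private theorem restrictNormalHom_eq_one_iff' (g : BaseGaloisGroup hp) :
    AlgEquiv.restrictNormalHom N g = 1 ↔ ∀ y : N, g • (y : NormedAlgClosure F) = y := by
  rw [show AlgEquiv.restrictNormalHom N g = g.restrictNormal N from rfl,
    AlgEquiv.restrictNormal_eq_one_iff]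
  constructor
  · intro h y; exact h y y.2
  · intro h y hy; exact h ⟨y, hy⟩

omit [FiniteDimensional (PadicBase F p hp) N] in
/-- In `ℂ_F`: `g • ↑↑y = ↑↑((g|_N) y)`. [folklore] -/
private theorem base_smul_coe_coe' (g : BaseGaloisGroup hp) (y : N) :
    g • (((y : NormedAlgClosure F)) : CompletedAlgClosure F) =
      (((AlgEquiv.restrictNormalHom N g y : N) : NormedAlgClosure F) : CompletedAlgClosure F) := by
  rw [CompletedAlgClosure.base_smul_coe]
  exact congrArg _ (AlgEquiv.restrictNormalHom_apply N g y).symm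

omit [FiniteDimensional (PadicBase F p hp) N] [IsGalois (PadicBase F p hp) N] in
/-- The double coercion `N → F̄ → ℂ_F` transports sums. [folklore] -/
private theorem coe_coe_sum' {κ : Type} (s : Finset κ) (f : κ → N) :
    (((∑ k ∈ s, f k : N) : NormedAlgClosure F) : CompletedAlgClosure F) =
      ∑ k ∈ s, (((f k : N) : NormedAlgClosure F) : CompletedAlgClosure F) :=
  map_sum ((Completion.coeRingHom : NormedAlgClosure F →+* CompletedAlgClosure F).comp
    (algebraMap N (NormedAlgClosure F))) f s

omit [FiniteDimensional (PadicBase F p hp) N] [IsGalois (PadicBase F p hp) N] in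
/-- The double coercion `N → F̄ → ℂ_F` is multiplicative. [folklore] -/
private theorem coe_coe_mul' (y y' : N) :
    (((y * y' : N) : NormedAlgClosure F) : CompletedAlgClosure F) =
      (((y : N) : NormedAlgClosure F) : CompletedAlgClosure F) *
        (((y' : N) : NormedAlgClosure F) : CompletedAlgClosure F) := by
  rw [IntermediateField.coe_mul, Completion.coe_mul]

omit [FiniteDimensional (PadicBase F p hp) N] [IsGalois (PadicBase F p hp) N] in
/-- The double coercion of `[P]` (`1` or `0`). [folklore] -/
private theorem coe_coe_ite' (P : Prop) [Decidable P] :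
    (((if P then (1 : N) else 0 : N) : NormedAlgClosure F) : CompletedAlgClosure F) =
      if P then 1 else 0 := by
  split_ifs <;> simp

/-- Elements of `X` are fixed by `H₀ = ker χ` (Ax–Sen–Tate, easy inclusion). [cite: Tate1967, §3.1] -/
private theorem smul_eq_self_of_mem_X {c : CompletedAlgClosure F} (hc : c ∈ X hp)
    {g : BaseGaloisGroup hp} (hg : g ∈ (BaseGaloisGroup.baseCyclotomicCharacter hp).ker) :
    g • c = c := by
  rw [← fixedPoints_eq_X hp] at hc
  exact hc g ((TateSen.mem_baseKer_iff_forall_smul_zeta hp g).mp hg)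

/-- ★ **Relative Tate coordinates: `ℂ_F^{H_N} = ⊕ᵢ bᵢ · \widehat{K_∞}`.**  Let `N ⊆ F̄` be finite Galois
over `K₀`, `H₀ = ker χ ≤ G₀` and `H_N = H₀ ∩ Gal(F̄/N)`.  There are `e ≥ 1`, families
`b, b^∨ : Fin e → N` and continuous additive maps `prᵢ : ℂ_F → ℂ_F` (`i : Fin e`) such that:
(1) `prᵢ` is continuous; (2) `prᵢ (c x) = c · prᵢ x` for `c ∈ X`; (3) `‖prᵢ x‖ ≤ ‖b^∨ᵢ‖ ‖x‖`;
(4) `prᵢ x ∈ X` for `x ∈ ℂ_F^{H_N}`; (5) `x = ∑ᵢ bᵢ · prᵢ x` for `x ∈ ℂ_F^{H_N}`;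
(6) `prᵢ (bⱼ c) = δᵢⱼ c` for `c ∈ X`; (7) `prᵢ (∑ⱼ bⱼ cⱼ) = cᵢ` for `cⱼ ∈ X` (uniqueness of
coordinates: `ℂ_F^{H_N}` is free over `X` on `b`); (8) `g • prᵢ x = prᵢ (g • x)` for `g ∈ Gal(F̄/N)` and
`x ∈ ℂ_F^{H_N}`; (9) `∑ⱼ bⱼ cⱼ ∈ ℂ_F^{H_N}` for `cⱼ ∈ X`.  Explicitly `prᵢ x = ∑_{s ∈ H₀|_N} g_s • (b^∨ᵢ x)`
with `b` a basis of `N` over `E = N^{H₀|_N}`, `b^∨` the `Tr_{N/E}`-dual basis and `g_s ∈ H₀` lifts of the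
elements of `H₀|_N ≤ Gal(N/K₀)`: (5) is the dual-basis identity `∑ᵢ bᵢ s(b^∨ᵢ) = [s = 1]`, (6) is
`Tr_{N/E}(b^∨ᵢ bⱼ) = ∑_s s(b^∨ᵢ bⱼ) = δᵢⱼ`, (4) is the re-indexing `h g_s ↦ g_{hs}` (`H_N`-invariance of
`b^∨ᵢ x`), (8) uses the normality of `H₀` and of `Gal(F̄/N)` in `G₀`.  This is the structure
`Λ̃^{H_L} = \widehat{L_∞} = L ⊗_{L ∩ K_∞} \widehat{K_∞}` behind the Tate–Sen condition (TS2) for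
`Λ̃ = ℂ_p` and a general open `H_L ≤ H₀`. [cite: BergerColmez2008, Déf. 3.1.3 (TS2) and Prop. 4.1.1]
[cite: Tate1967, §3.2 Prop. 9] [cite: BrinonConrad2009, Thm. 15.1.2] -/
theorem exists_relCoordinates :
    ∃ (e : ℕ) (b bd : Fin e → N) (pr : Fin e → (CompletedAlgClosure F →+ CompletedAlgClosure F)),
      0 < e ∧
      (∀ i, Continuous (pr i)) ∧
      (∀ i, ∀ c ∈ X hp, ∀ x, pr i (c * x) = c * pr i x) ∧
      (∀ i x, ‖pr i x‖ ≤ ‖(((bd i : N) : NormedAlgClosure F) : CompletedAlgClosure F)‖ * ‖x‖) ∧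
      (∀ i (x : CompletedAlgClosure F),
        (∀ g ∈ (BaseGaloisGroup.baseCyclotomicCharacter hp).ker,
          (∀ y : N, g • (y : NormedAlgClosure F) = y) → g • x = x) → pr i x ∈ X hp) ∧
      (∀ x : CompletedAlgClosure F,
        (∀ g ∈ (BaseGaloisGroup.baseCyclotomicCharacter hp).ker,
          (∀ y : N, g • (y : NormedAlgClosure F) = y) → g • x = x) →
        x = ∑ i, (((b i : N) : NormedAlgClosure F) : CompletedAlgClosure F) * pr i x) ∧
      (∀ i j, ∀ c ∈ X hp,
        pr i ((((b j : N) : NormedAlgClosure F) : CompletedAlgClosure F) * c) =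
          if i = j then c else 0) ∧
      (∀ c : Fin e → CompletedAlgClosure F, (∀ j, c j ∈ X hp) → ∀ i,
        pr i (∑ j, (((b j : N) : NormedAlgClosure F) : CompletedAlgClosure F) * c j) = c i) ∧
      (∀ i (g : BaseGaloisGroup hp), (∀ y : N, g • (y : NormedAlgClosure F) = y) →
        ∀ x : CompletedAlgClosure F,
          (∀ g ∈ (BaseGaloisGroup.baseCyclotomicCharacter hp).ker,
            (∀ y : N, g • (y : NormedAlgClosure F) = y) → g • x = x) →
          g • pr i x = pr i (g • x)) ∧
      (∀ c : Fin e → CompletedAlgClosure F, (∀ j, c j ∈ X hp) →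
        ∀ g ∈ (BaseGaloisGroup.baseCyclotomicCharacter hp).ker,
          (∀ y : N, g • (y : NormedAlgClosure F) = y) →
          g • (∑ j, (((b j : N) : NormedAlgClosure F) : CompletedAlgClosure F) * c j) =
            ∑ j, (((b j : N) : NormedAlgClosure F) : CompletedAlgClosure F) * c j) := by
  classical
  -- the groups `H₀ ≤ G₀`, `Q = Gal(N/K₀)`, the restriction `r` and the image `S = H₀|_N`
  let H0 : Subgroup (BaseGaloisGroup hp) := (BaseGaloisGroup.baseCyclotomicCharacter hp).ker
  have hN : H0.Normal := MonoidHom.normal_ker _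
  let Q := N ≃ₐ[PadicBase F p hp] N
  let r : BaseGaloisGroup hp →* Q := AlgEquiv.restrictNormalHom N
  let S : Subgroup Q := H0.map r
  -- the dual families
  obtain ⟨e, b, bd, he, hI1, hI2⟩ := exists_dual_family (K := PadicBase F p hp) (L := N) S
  -- lifts `g_s ∈ H₀` of the elements of `S`
  have hlift : ∀ s : S, ∃ g : BaseGaloisGroup hp, g ∈ H0 ∧ r g = s := fun s => by
    obtain ⟨g, hg, hgs⟩ := Subgroup.mem_map.mp s.2
    exact ⟨g, hg, hgs⟩
  choose lift hliftH hliftr using hlift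
  -- `H_N`-fixed elements
  let Fix : CompletedAlgClosure F → Prop := fun x =>
    ∀ g ∈ H0, (∀ y : N, g • (y : NormedAlgClosure F) = y) → g • x = x
  -- basic facts
  have r_eq_one_iff : ∀ g : BaseGaloisGroup hp,
      r g = 1 ↔ ∀ y : N, g • (y : NormedAlgClosure F) = y :=
    fun g => restrictNormalHom_eq_one_iff' hp N g
  have lift_smul_coe : ∀ (s : S) (y : N),
      lift s • (((y : NormedAlgClosure F)) : CompletedAlgClosure F) =
        ((((s : Q) y : N) : NormedAlgClosure F) : CompletedAlgClosure F) := by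
    intro s y
    rw [base_smul_coe_coe' hp N, ← hliftr s]
  have smul_coe_of_fixN : ∀ {g : BaseGaloisGroup hp}, (∀ y : N, g • (y : NormedAlgClosure F) = y) →
      ∀ y : N, g • (((y : NormedAlgClosure F)) : CompletedAlgClosure F) =
        ((y : NormedAlgClosure F) : CompletedAlgClosure F) := by
    intro g hg y
    rw [CompletedAlgClosure.base_smul_coe, hg y]
  -- the dual-basis identities in `ℂ_F`
  have hI1' : ∀ i j, ∑ s : S, ((((s : Q) (bd i * b j) : N) : NormedAlgClosure F) : CompletedAlgClosure F) =
      if i = j then 1 else 0 := by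
    intro i j
    rw [← coe_coe_ite' hp N (i = j), ← hI1 i j, coe_coe_sum' hp N]
  have hI2' : ∀ s : S, ∑ i, (((b i : N) : NormedAlgClosure F) : CompletedAlgClosure F) *
      ((((s : Q) (bd i) : N) : NormedAlgClosure F) : CompletedAlgClosure F) =
      if s = 1 then 1 else 0 := by
    intro s
    rw [← coe_coe_ite' hp N (s = 1), ← hI2 s, coe_coe_sum' hp N]
    exact Finset.sum_congr rfl fun i _ => (coe_coe_mul' hp N _ _).symm
  -- `g • x` depends only on `r g` for `g ∈ H₀` when `x` is `H_N`-fixed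
  have smul_eq_of_r_eq : ∀ {g g' : BaseGaloisGroup hp}, g ∈ H0 → g' ∈ H0 → r g = r g' →
      ∀ {x}, Fix x → g • x = g' • x := by
    intro g g' hg hg' hr x hx
    have h1 : (g'⁻¹ * g) • x = x := by
      refine hx _ (H0.mul_mem (H0.inv_mem hg') hg) ((r_eq_one_iff _).mp ?_)
      rw [map_mul, map_inv, hr, inv_mul_cancel]
    have := congrArg (fun y => g' • y) h1
    simpa only [← mul_smul, mul_inv_cancel_left] using this
  -- `H_N`-fixedness is preserved by multiplication with `↑↑y` and by `g ∈ Gal(F̄/N)`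
  have fix_coe_mul : ∀ (y : N) {x}, Fix x →
      Fix ((((y : NormedAlgClosure F)) : CompletedAlgClosure F) * x) := by
    intro y x hx g hg hgN
    rw [smul_mul', smul_coe_of_fixN hgN, hx g hg hgN]
  have fix_smul : ∀ {g : BaseGaloisGroup hp}, (∀ y : N, g • (y : NormedAlgClosure F) = y) →
      ∀ {x}, Fix x → Fix (g • x) := by
    intro g hgN x hx k hk hkN
    have hconj : g⁻¹ * k * g⁻¹⁻¹ ∈ H0 := hN.conj_mem k hk g⁻¹
    rw [inv_inv] at hconj
    have hfixN : ∀ y : N, (g⁻¹ * k * g) • (y : NormedAlgClosure F) = y := by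
      refine (r_eq_one_iff _).mp ?_
      rw [map_mul, map_mul, (r_eq_one_iff k).mpr hkN, mul_one, ← map_mul, inv_mul_cancel, map_one]
    have h1 := hx _ hconj hfixN
    calc k • g • x = g • ((g⁻¹ * k * g) • x) := by
          rw [← mul_smul, ← mul_smul, ← mul_assoc, ← mul_assoc, mul_inv_cancel, one_mul]
      _ = g • x := by rw [h1]
  -- the coordinate maps
  let pr : Fin e → (CompletedAlgClosure F →+ CompletedAlgClosure F) := fun i =>
    AddMonoidHom.mk' (fun x => ∑ s : S,
      lift s • ((((bd i : N) : NormedAlgClosure F) : CompletedAlgClosure F) * x)) (by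
      intro x y
      simp only [mul_add, smul_add, Finset.sum_add_distrib])
  have pr_apply : ∀ i x, pr i x = ∑ s : S,
      lift s • ((((bd i : N) : NormedAlgClosure F) : CompletedAlgClosure F) * x) := fun _ _ => rfl
  -- (6) coordinates of `b_j c`
  have pr_coord : ∀ i j, ∀ c ∈ X hp,
      pr i ((((b j : N) : NormedAlgClosure F) : CompletedAlgClosure F) * c) =
        if i = j then c else 0 := by
    intro i j c hc
    rw [pr_apply]
    have key : ∀ s : S,
        lift s • ((((bd i : N) : NormedAlgClosure F) : CompletedAlgClosure F) *
          ((((b j : N) : NormedAlgClosure F) : CompletedAlgClosure F) * c)) =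
        ((((s : Q) (bd i * b j) : N) : NormedAlgClosure F) : CompletedAlgClosure F) * c := by
      intro s
      rw [← mul_assoc, ← coe_coe_mul' hp N, smul_mul', lift_smul_coe,
        smul_eq_self_of_mem_X hp hc (hliftH s)]
    simp_rw [key]
    rw [← Finset.sum_mul, hI1' i j]
    split_ifs <;> simp
  -- (9) the `X`-span of `b` is `H_N`-fixed
  have span_fix : ∀ c : Fin e → CompletedAlgClosure F, (∀ j, c j ∈ X hp) →
      Fix (∑ j, (((b j : N) : NormedAlgClosure F) : CompletedAlgClosure F) * c j) := by
    intro c hc g hg hgN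
    rw [Finset.smul_sum]
    refine Finset.sum_congr rfl fun j _ => ?_
    rw [smul_mul', smul_coe_of_fixN hgN, smul_eq_self_of_mem_X hp (hc j) hg]
  refine ⟨e, b, bd, pr, he, ?_, ?_, ?_, ?_, ?_, pr_coord, ?_, ?_, span_fix⟩
  · -- (1) continuity
    intro i
    have h : (pr i : CompletedAlgClosure F → CompletedAlgClosure F) = fun x => ∑ s : S,
        lift s • ((((bd i : N) : NormedAlgClosure F) : CompletedAlgClosure F) * x) :=
      funext (pr_apply i)
    rw [h]
    exact continuous_finsetSum _ fun s _ =>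
      (CompletedAlgClosure.continuous_base_smul hp _).comp (continuous_const.mul continuous_id)
  · -- (2) `X`-linearity
    intro i c hc x
    rw [pr_apply, pr_apply, Finset.mul_sum]
    refine Finset.sum_congr rfl fun s _ => ?_
    rw [mul_left_comm, smul_mul', smul_eq_self_of_mem_X hp hc (hliftH s)]
  · -- (3) norm bound
    intro i x
    rw [pr_apply]
    refine IsUltrametricDist.norm_sum_le_of_forall_le_of_nonneg
      (mul_nonneg (norm_nonneg _) (norm_nonneg _)) fun s _ => ?_
    exact le_of_eq (by rw [CompletedAlgClosure.norm_base_smul, norm_mul])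
  · -- (4) values in `X`
    intro i x hx
    have hx' : Fix x := hx
    have hz : Fix ((((bd i : N) : NormedAlgClosure F) : CompletedAlgClosure F) * x) :=
      fix_coe_mul (bd i) hx'
    rw [← fixedPoints_eq_X hp]
    intro h hh'
    have hh : h ∈ H0 := (TateSen.mem_baseKer_iff_forall_smul_zeta hp h).mpr hh'
    rw [pr_apply, Finset.smul_sum]
    simp_rw [← mul_smul]
    -- `h g_s • z = g_{ρ s} • z` with `ρ = r h ∈ S`
    let ρ : S := ⟨r h, Subgroup.mem_map_of_mem r hh⟩
    have key : ∀ s : S,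
        (h * lift s) • ((((bd i : N) : NormedAlgClosure F) : CompletedAlgClosure F) * x) =
          lift (ρ * s) • ((((bd i : N) : NormedAlgClosure F) : CompletedAlgClosure F) * x) := by
      intro s
      refine smul_eq_of_r_eq (H0.mul_mem hh (hliftH s)) (hliftH _) ?_ hz
      rw [map_mul, hliftr, hliftr, Subgroup.coe_mul]
    simp_rw [key]
    exact Fintype.sum_bijective (ρ * ·) (Group.mulLeft_bijective ρ) _ _ fun s => rfl
  · -- (5) reconstruction `x = ∑ b_i pr_i x`
    intro x hx
    have hx' : Fix x := hx
    rw [show (∑ i, (((b i : N) : NormedAlgClosure F) : CompletedAlgClosure F) * pr i x) =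
        ∑ i, (((b i : N) : NormedAlgClosure F) : CompletedAlgClosure F) * ∑ s : S,
          lift s • ((((bd i : N) : NormedAlgClosure F) : CompletedAlgClosure F) * x) from
      Finset.sum_congr rfl fun i _ => by rw [pr_apply]]
    symm
    calc ∑ i, (((b i : N) : NormedAlgClosure F) : CompletedAlgClosure F) * ∑ s : S,
          lift s • ((((bd i : N) : NormedAlgClosure F) : CompletedAlgClosure F) * x)
        = ∑ s : S, (∑ i, (((b i : N) : NormedAlgClosure F) : CompletedAlgClosure F) *
            ((((s : Q) (bd i) : N) : NormedAlgClosure F) : CompletedAlgClosure F)) * (lift s • x) := by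
          simp_rw [Finset.mul_sum, smul_mul', lift_smul_coe, ← mul_assoc]
          rw [Finset.sum_comm]
          simp_rw [Finset.sum_mul]
      _ = ∑ s : S, (if s = 1 then (1 : CompletedAlgClosure F) else 0) * (lift s • x) :=
          Finset.sum_congr rfl fun s _ => by rw [hI2' s]
      _ = lift 1 • x := by
          simp_rw [ite_mul, one_mul, zero_mul]
          rw [Finset.sum_ite_eq' Finset.univ (1 : S) (fun s => lift s • x), if_pos (Finset.mem_univ _)]
      _ = x := hx' _ (hliftH 1) ((r_eq_one_iff _).mp (by rw [hliftr, Subgroup.coe_one]))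
  · -- (7) uniqueness of coordinates
    intro c hc i
    rw [map_sum]
    have h : ∀ j, pr i ((((b j : N) : NormedAlgClosure F) : CompletedAlgClosure F) * c j) =
        if i = j then c j else 0 := fun j => pr_coord i j (c j) (hc j)
    rw [Finset.sum_congr rfl fun j _ => h j, Finset.sum_ite_eq Finset.univ i c,
      if_pos (Finset.mem_univ _)]
  · -- (8) equivariance under `Gal(F̄/N)`
    intro i g hgN x hx
    have hx' : Fix x := hx
    rw [pr_apply, pr_apply, Finset.smul_sum]
    refine Finset.sum_congr rfl fun s _ => ?_
    have hz : Fix ((((bd i : N) : NormedAlgClosure F) : CompletedAlgClosure F) * (g • x)) :=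
      fix_coe_mul (bd i) (fix_smul hgN hx')
    have hconj : g * lift s * g⁻¹ ∈ H0 := hN.conj_mem _ (hliftH s) g
    calc g • lift s • ((((bd i : N) : NormedAlgClosure F) : CompletedAlgClosure F) * x)
        = (g * lift s * g⁻¹) • (g • ((((bd i : N) : NormedAlgClosure F) : CompletedAlgClosure F) * x)) := by
          rw [← mul_smul, ← mul_smul, inv_mul_cancel_right]
      _ = (g * lift s * g⁻¹) • ((((bd i : N) : NormedAlgClosure F) : CompletedAlgClosure F) * (g • x)) := by
          rw [smul_mul' g, smul_coe_of_fixN hgN]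
      _ = lift s • ((((bd i : N) : NormedAlgClosure F) : CompletedAlgClosure F) * (g • x)) := by
          refine smul_eq_of_r_eq hconj (hliftH s) ?_ hz
          rw [map_mul, map_mul, map_inv, (r_eq_one_iff g).mpr hgN, one_mul, inv_one, mul_one]

end TateTrace

end Literature.NumberTheory.PAdicHodge
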